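import Mathlib
import Summits.ValiantsHypothesis.ValiantsHypothesis.Theses.FeketeSOS

/-!
# Crux `FeketeSOS.CharPSparseSOS` (stmt-ValiantsHypothesis-14989) — idea `steinberg-two-cusp`, first lemmas

crux-ideate round 1, ideator 2 (planner-cruxidea-stmt-ValiantsHypothesis-14989-2-0), 2026-08-16.

The coefficient function `h : 𝔽_p → K` of a polynomial `P` of degree `< p` (read cyclically in `K[X]/(X^p-1)
= K[ℤ/p]`) is a vector of the STEINBERG module of `SL₂(𝔽_p)` (sum-zero functions on `ℙ¹(𝔽_p)`, `h(∞) := -Σ h`).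
Two cusps, two depths:
* `δ_∞(P) = rootMultiplicity 1 P` (the route's char-`p` multiplicity lever) `= #` leading vanishing power moments
  `μ_a(P) = Σ_n P.coeff n · n^a`, `a = 0, 1, …`;
* `δ_0(P) =` multiplicity of `U = 0` as a root of the Lagrange interpolation polynomial of `n ↦ P.coeff n`
  `=` (given `P.coeff 0 = 0`) the number of vanishing TOP moments `μ_{p-2}, μ_{p-3}, …`.
The Weyl element `w : h ↦ (n ↦ h(-1/n))` (value `-Σh` at `0`) preserves sparsity up to `±1`, swaps the two depths and
fixes `F̄_p = χ_p` up to `χ_p(-1)`; `F̄_p` has BOTH depths equal to `M = (p-1)/2` (its interpolation polynomial is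
`U^M`), whereas the cheap socle objects (digit tilings: `Σ_{m<p} X^m = (X-1)^{p-1}`) have `δ_0 = 0`.
Load-bearing conjecture `UFA2` (two-cusp fewnomial inequality, uniform in the number of squares):
`min(δ_∞, δ_0)(Σ_{i<s} c_i g_i²  mod X^p-1) ≤ C·(s+1)^A·Σ_i #supp g_i` — it implies the crux (`Composition`).
Everything below is a `Prop` (statements to be proved by the line), except the unconditional algebra is marked.
-/

namespace Summit.ValiantsHypothesis.ValiantsHypothesis.Cruxes.CharPSparseSOS.SteinbergTwoCusp

open Polynomial Finset
open scoped BigOperators Classical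

set_option linter.dupNamespace false
set_option linter.unusedVariables false

section Defs

variable (K : Type) [Field K] (p : ℕ)

/-- The reduced Fekete polynomial `F̄_p = Σ_{m<p} (m|p) X^m ∈ K[X]`, literally the polynomial inlined in the crux. -/
noncomputable def fekete [Fact p.Prime] : K[X] :=
  ∑ m ∈ range p, C ((legendreSym p m : ℤ) : K) * X ^ m

/-- Power moment `μ_a(P) = Σ_n P.coeff n · n^a` of the coefficient function (`0^0 = 1`). -/
noncomputable def moment (P : K[X]) (a : ℕ) : K :=
  ∑ n ∈ P.support, P.coeff n * (n : K) ^ a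

/-- Upper-cusp depth `≥ D`: `(X-1)^D ∣ P` (order at the unipotent point; the route's Euler/Hajós lever). -/
def HasCuspDepthInf (P : K[X]) (D : ℕ) : Prop :=
  (X - C (1 : K)) ^ D ∣ P

/-- Lower-cusp depth `≥ D`: the interpolation polynomial of `n ↦ P.coeff n` is divisible by `U^D`; in moment
language: `P.coeff 0 = 0` and the TOP moments `μ_{p-1-d}(P)`, `1 ≤ d < D`, vanish (`n^{p-1-d} = n^{-d}` on `𝔽_pˣ`). -/
def HasCuspDepthZero (P : K[X]) (D : ℕ) : Prop :=
  (1 ≤ D → P.coeff 0 = 0) ∧ ∀ d : ℕ, 1 ≤ d → d < D → moment K P (p - 1 - d) = 0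

/-- The Lagrange interpolation polynomial (degree `≤ p-1`) of the coefficient function `n ↦ P.coeff n` on `𝔽_p`:
`Σ_{n<p} P.coeff n · (1 - (U - n)^{p-1})`. -/
noncomputable def interp (P : K[X]) : K[X] :=
  ∑ n ∈ range p, C (P.coeff n) * (1 - (X - C (n : K)) ^ (p - 1))

/-- Coefficient function of the Weyl transform `w·h`: `(w h)(n) = h(-1/n)` for `n ≠ 0`, `(w h)(0) = -Σ_m h(m)`
(the value of `h` at the point `∞` of `ℙ¹(𝔽_p)` in the Steinberg module). -/
noncomputable def weylCoeff [NeZero p] (P : K[X]) (n : ℕ) : K :=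
  if n % p = 0 then -(∑ m ∈ range p, P.coeff m) else P.coeff ((-((n : ZMod p)⁻¹)).val)

/-- The Weyl transform as a polynomial of degree `< p`. -/
noncomputable def weyl [NeZero p] (P : K[X]) : K[X] :=
  ∑ n ∈ range p, C (weylCoeff K p P n) * X ^ n

/-- Cyclic fold of a polynomial to degree `< p` (remainder modulo the monic `X^p - 1`). -/
noncomputable def fold (P : K[X]) : K[X] :=
  P %ₘ (X ^ p - 1)

end Defs

section Statements

/-- DICTIONARY (∞): for `deg P < p` over a field of characteristic `p`, `(X-1)^D ∣ P` iff the first `D` power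
moments vanish (`D ≤ p`; Taylor coefficients at `1` are binomial moments, and `{C(n,a)}_{a<D}` and `{n^a}_{a<D}`
span the same space of polynomial functions since `a! ≠ 0` for `a < p`).  Unconditional algebra. -/
def DictionaryAtInfinity : Prop :=
  ∀ (K : Type) [Field K] (p : ℕ) [Fact p.Prime] [CharP K p] (P : K[X]) (D : ℕ),
    P.natDegree < p → D ≤ p →
      (HasCuspDepthInf K P D ↔ ∀ a : ℕ, a < D → moment K P a = 0)

/-- DICTIONARY (0): `interp P = (η₀+η_{p-1}) - Σ_{a=1}^{p-2} a!·η_a·U^{p-1-a} - η₀·U^{p-1}` with `η_a = μ_a/a!`, hence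
the moment definition of the lower depth is divisibility of the interpolation polynomial by `U^D`
(`D ≤ p - 1`).  Unconditional algebra (Lagrange with `1-(U-n)^{p-1}`, `C(p-1,d) ≡ (-1)^d`). -/
def DictionaryAtZero : Prop :=
  ∀ (K : Type) [Field K] (p : ℕ) [Fact p.Prime] [CharP K p] (P : K[X]) (D : ℕ),
    P.natDegree < p → D ≤ p - 1 →
      (HasCuspDepthZero K p P D ↔ (X : K[X]) ^ D ∣ interp K p P)

/-- TWO-CUSP HAJÓS: a nonzero `t`-sparse `g` of degree `< p` has `δ_∞(g) ≤ t - 1` (landed: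
`FeketeNoSparseSplitCyclic.cpf_main`) AND `δ_0(g) ≤ t` (the interpolation polynomial is `Q·Π_{a ∉ supp}(U-a)` with
`deg Q < t`).  Unconditional. -/
def TwoCuspHajos : Prop :=
  ∀ (K : Type) [Field K] (p : ℕ) [Fact p.Prime] [CharP K p] (g : K[X]) (D : ℕ),
    g ≠ 0 → g.natDegree < p → HasCuspDepthZero K p g D → D ≤ g.support.card

/-- TWO-CUSP UNCERTAINTY: `δ_∞(P) + δ_0(P) ≤ p - 1` for nonzero `P` of degree `< p` (the two unipotent flags of the
Steinberg module are transversal); equality iff the coefficient function is `n ↦ c·n^d`, a dilation weight vector —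
`F̄_p` (`d = (p-1)/2`) is the self-dual extremal.  Unconditional. -/
def TwoCuspUncertainty : Prop :=
  ∀ (K : Type) [Field K] (p : ℕ) [Fact p.Prime] [CharP K p] (P : K[X]) (D₁ D₂ : ℕ),
    P ≠ 0 → P.natDegree < p → HasCuspDepthInf K P D₁ → HasCuspDepthZero K p P D₂ → D₁ + D₂ ≤ p - 1

/-- WEYL SYMMETRY: `w` swaps the two depths, is an involution on polynomials of degree `< p`, changes the support
size by at most one, and fixes `F̄_p` up to the sign `χ_p(-1)`.  Unconditional (permutation `n ↦ -1/n` of `𝔽_pˣ`,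
coefficient reversal `U^d ↦ ±U^{p-1-d}` of interpolation polynomials). -/
def WeylSymmetry : Prop :=
  ∀ (K : Type) [Field K] (p : ℕ) [Fact p.Prime] [CharP K p] (P : K[X]) (D : ℕ),
    P.natDegree < p →
      (HasCuspDepthInf K P D ↔ HasCuspDepthZero K p (weyl K p P) D) ∧
      (HasCuspDepthZero K p P D ↔ HasCuspDepthInf K (weyl K p P) D) ∧
      weyl K p (weyl K p P) = P ∧
      (weyl K p P).support.card ≤ P.support.card + 1 ∧ P.support.card ≤ (weyl K p P).support.card + 1 ∧
      weyl K p (fekete K p) = C ((legendreSym p (-1) : ℤ) : K) * fekete K p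

/-- THE TARGET SITS AT THE SELF-DUAL POINT: `δ_∞(F̄_p) = δ_0(F̄_p) = (p-1)/2` exactly (`p` odd): the `∞` half is
Euler + power sums (landed `stub_feketeModPOrder` / `LeverExactOrder`); the `0` half is its `w`-image, equivalently
the twisted moments `Σ_n χ(n) n^{-d} = 0` for `1 ≤ d < (p-1)/2` — the interpolation polynomial of `χ_p` is `U^{(p-1)/2}`. -/
def FeketeTwoCusp : Prop :=
  ∀ (K : Type) [Field K] (p : ℕ) [Fact p.Prime] [CharP K p], p ≠ 2 →
    HasCuspDepthInf K (fekete K p) ((p - 1) / 2) ∧ ¬ HasCuspDepthInf K (fekete K p) ((p - 1) / 2 + 1) ∧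
    HasCuspDepthZero K p (fekete K p) ((p - 1) / 2) ∧ ¬ HasCuspDepthZero K p (fekete K p) ((p - 1) / 2 + 1)

/-- SOCLE IS ONE-CUSP (the negative knowledge, restated positively): the digit tiling
`Σ_{m<p} X^m = [a]_X·[b]_{X^a} + X^{ab}·[c]_X = (X-1)^{p-1}` (`p = ab + c`), which kills every ONE-sided
order-vs-sparsity inequality (Theorems/FeketeBoundedFanin/Negative/UnipotentFewnomialABCFalse), has lower depth `0`:
its interpolation polynomial is the constant `1`.  More generally `δ_0 ≤ p - 1 - δ_∞`. Unconditional. -/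
def SocleIsOneCusp : Prop :=
  ∀ (K : Type) [Field K] (p : ℕ) [Fact p.Prime] [CharP K p],
    ¬ HasCuspDepthZero K p (∑ m ∈ range p, (X : K[X]) ^ m) 1

/-- **UFA² — the two-cusp fewnomial inequality (LOAD-BEARING CONJECTURE, uniform in the number of squares).**
A nonzero cyclic sum of `s` weighted squares of polynomials of degree `< p` cannot be deep at BOTH cusps beyond a
constant (polynomial in `s`) times its support-sum: `min(δ_∞, δ_0) ≤ C·(s+1)^A·Σ #supp g_i`.
Calibration (this card's experiments/NOTES): `C ≥ 1` is necessary in product accounting (subgroup hybrid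
`t·1_{μ_d} - 1_{≠0}`, interpolation corrections); tilings, θ-ladders, Gauss periods, Frobenius all have `min = O(cost)`. -/
def UFA2 (C₀ A₀ : ℕ) : Prop :=
  ∀ (K : Type) [Field K] (p : ℕ) [Fact p.Prime] [CharP K p] (s : ℕ) (c : Fin s → K) (g : Fin s → K[X]),
    (∀ i, (g i).natDegree < p) →
      fold K p (∑ i, C (c i) * g i ^ 2) ≠ 0 →
        ∀ D : ℕ, HasCuspDepthInf K (fold K p (∑ i, C (c i) * g i ^ 2)) D →
          HasCuspDepthZero K p (fold K p (∑ i, C (c i) * g i ^ 2)) D →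
            D ≤ C₀ * (s + 1) ^ A₀ * ∑ i, (g i).support.card

/-- The bounded-products form of UFA² with an absolute constant (what the experiments measure; `t` products of two
fewnomials each; conjecturally `C = 1 + o(1)`). -/
def UFA2Products (C₀ : ℕ) : Prop :=
  ∀ (K : Type) [Field K] (p : ℕ) [Fact p.Prime] [CharP K p] (t : ℕ) (A B : Fin t → K[X]),
    (∀ l, (A l).natDegree < p ∧ (B l).natDegree < p) →
      fold K p (∑ l, A l * B l) ≠ 0 →
        ∀ D : ℕ, HasCuspDepthInf K (fold K p (∑ l, A l * B l)) D →
          HasCuspDepthZero K p (fold K p (∑ l, A l * B l)) D →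
            D ≤ C₀ * ∑ l, ((A l).support.card + (B l).support.card)

/-- COMPOSITION: the target's two depths (`FeketeTwoCusp`) and the two-cusp inequality give the crux with
`δ = 1/(2(A+2))`: a cyclic representation `X^p - 1 ∣ Σ c_i g_i² - F̄_p` has fold `F̄_p ≠ 0`, so
`(p-1)/2 ≤ C (s+1)^A Σ#supp g_i ≤ C (2p^δ)^A Σ#supp g_i`, i.e. `Σ#supp g_i ≥ p^{1-Aδ}/(C·2^{A+1}) ≥ p^{1/2+δ}` for
`p ≥ p₀(C, A)`. -/
def Composition : Prop :=
  FeketeTwoCusp → (∃ C₀ A₀ : ℕ, UFA2 C₀ A₀) → Theses.FeketeSOS.CharPSparseSOS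

end Statements

section Checks

/-! Tiny unconditional checks that the definitions say what the docstrings say. -/

example (K : Type) [Field K] (p : ℕ) (P : K[X]) : HasCuspDepthInf K P 0 := by
  simp [HasCuspDepthInf]

example (K : Type) [Field K] (p : ℕ) (P : K[X]) : HasCuspDepthZero K p P 0 := by
  refine ⟨fun h => absurd h (by omega), fun d h1 h2 => absurd h2 (by omega)⟩

example (K : Type) [Field K] (p : ℕ) (P : K[X]) : HasCuspDepthZero K p P 1 ↔ P.coeff 0 = 0 := by
  constructor
  · intro h; exact h.1 le_rfl
  · intro h; exact ⟨fun _ => h, fun d h1 h2 => absurd h2 (by omega)⟩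

end Checks

/-! ### Kernel-checked: the socle tiling is one-cusp, and UFA² + the target's two depths give the crux. -/

/-- The constant coefficient of `Σ_{m<p} X^m` is `1`, so its lower-cusp depth is `0`: the digit tiling
(`= (X-1)^{p-1}`, upper depth `p-1`) is invisible to `min(δ_∞, δ_0)`. -/
theorem socleIsOneCusp : SocleIsOneCusp := by
  intro K _ p hp _ h
  have h0 : (∑ m ∈ range p, (X : K[X]) ^ m).coeff 0 = 0 := h.1 le_rfl
  rw [finsetSum_coeff] at h0
  rw [Finset.sum_eq_single_of_mem 0 (Finset.mem_range.2 hp.out.pos)] at h0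
  · simp at h0
  · intro b _ hb
    rw [coeff_X_pow, if_neg (Ne.symm hb)]

/-- `F̄_p` has degree `< p`. -/
theorem degree_fekete_lt (K : Type) [Field K] (p : ℕ) [Fact p.Prime] :
    (fekete K p).degree < p := by
  unfold fekete
  refine lt_of_le_of_lt (degree_sum_le _ _) ((Finset.sup_lt_iff (WithBot.bot_lt_coe p)).2 ?_)
  intro m hm
  refine lt_of_le_of_lt (degree_C_mul_X_pow_le m _) ?_
  exact WithBot.coe_lt_coe.2 (Finset.mem_range.1 hm)

/-- **Composition** (kernel-checked): `FeketeTwoCusp → (∃ C₀ A₀, UFA2 C₀ A₀) → CharPSparseSOS`, with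
`δ = 1/(2(A₀+2))`. -/
theorem composition : Composition := by
  intro hF hU
  obtain ⟨C₀, A₀, hU⟩ := hU
  set δ : ℝ := 1 / (2 * ((A₀ : ℝ) + 2)) with hδ
  have hδpos : 0 < δ := by rw [hδ]; positivity
  have hexp : (δ * (A₀ : ℝ) + (1 / 2 + δ)) + δ = 1 := by
    rw [hδ]; field_simp; ring
  set L : ℝ := 4 * ((C₀ : ℝ) * 2 ^ A₀) with hL
  have hL0 : 0 ≤ L := by rw [hL]; positivity
  obtain ⟨N, hN⟩ : ∃ N : ℕ, L ^ (1 / δ) ≤ (N : ℝ) := ⟨_, Nat.le_ceil _⟩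
  refine ⟨δ, hδpos, max N 5, ?_⟩
  intro p _ hp K _ _ s c g hs hdeg hdvd
  have hprime : p.Prime := Fact.out
  have hp5 : 5 ≤ p := le_trans (le_max_right _ _) hp
  have hpN : N ≤ p := le_trans (le_max_left _ _) hp
  have hp2 : p ≠ 2 := by omega
  have hp1 : (1 : ℝ) ≤ (p : ℝ) := by exact_mod_cast hprime.one_lt.le
  have hp0 : (0 : ℝ) < (p : ℝ) := by linarith
  -- the fold of the representation IS `F̄_p`
  have hmonic : ((X : K[X]) ^ p - 1).Monic :=
    monic_X_pow_sub (by rw [degree_one]; exact_mod_cast hprime.pos)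
  have hdegq : ((X : K[X]) ^ p - 1).degree = p := by
    rw [← C_1, degree_X_pow_sub_C hprime.pos]
  have hfold : fold K p (∑ i, C (c i) * g i ^ 2) = fekete K p := by
    unfold fold
    rw [modByMonic_eq_of_dvd_sub hmonic hdvd]
    exact (modByMonic_eq_self_iff hmonic).2 (by rw [hdegq]; exact degree_fekete_lt K p)
  obtain ⟨hInf, hInfNot, hZero, -⟩ := hF K p hp2
  have hne : fekete K p ≠ 0 := by
    intro h0; exact hInfNot (by rw [h0]; exact dvd_zero _)
  have hmain := hU K p s c g hdeg (by rw [hfold]; exact hne) ((p - 1) / 2)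
    (by rw [hfold]; exact hInf) (by rw [hfold]; exact hZero)
  -- cast to ℝ
  set T : ℕ := ∑ i, (g i).support.card with hT
  have hcastT : (∑ i, ((g i).support.card : ℝ)) = (T : ℝ) := by rw [hT]; push_cast; rfl
  rw [hcastT]
  have hT0 : (0 : ℝ) ≤ (T : ℝ) := Nat.cast_nonneg T
  have hmainR : ((p : ℝ) - 2) / 2 ≤ (C₀ : ℝ) * ((s : ℝ) + 1) ^ A₀ * (T : ℝ) := by
    have h1 : p - 2 ≤ 2 * ((p - 1) / 2) := by omega
    have h2 : 2 * ((p - 1) / 2) ≤ 2 * (C₀ * (s + 1) ^ A₀ * T) := Nat.mul_le_mul_left 2 hmain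
    have h3 : ((p - 2 : ℕ) : ℝ) ≤ ((2 * (C₀ * (s + 1) ^ A₀ * T) : ℕ) : ℝ) := by exact_mod_cast h1.trans h2
    have h4 : ((p - 2 : ℕ) : ℝ) = (p : ℝ) - 2 := by
      rw [Nat.cast_sub (by omega : 2 ≤ p)]; norm_num
    rw [h4] at h3; push_cast at h3; linarith
  have hquarter : (p : ℝ) / 4 ≤ ((p : ℝ) - 2) / 2 := by
    have : (5 : ℝ) ≤ (p : ℝ) := by exact_mod_cast hp5
    linarith
  -- (s+1)^A₀ ≤ 2^A₀ p^(δ A₀)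
  have hpδ1 : (1 : ℝ) ≤ (p : ℝ) ^ δ := Real.one_le_rpow hp1 hδpos.le
  have hs1 : (s : ℝ) + 1 ≤ 2 * (p : ℝ) ^ δ := by linarith
  have hsA : ((s : ℝ) + 1) ^ A₀ ≤ (2 : ℝ) ^ A₀ * (p : ℝ) ^ (δ * A₀) := by
    have h := pow_le_pow_left₀ (by positivity) hs1 A₀
    have e : (2 * (p : ℝ) ^ δ) ^ A₀ = (2 : ℝ) ^ A₀ * (p : ℝ) ^ (δ * A₀) := by
      rw [mul_pow, ← Real.rpow_natCast ((p : ℝ) ^ δ) A₀, ← Real.rpow_mul hp0.le]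
    rw [e] at h; exact h
  set K₀ : ℝ := (C₀ : ℝ) * 2 ^ A₀ with hK₀
  have hK₀0 : 0 ≤ K₀ := by rw [hK₀]; positivity
  have hkey : (p : ℝ) / 4 ≤ K₀ * (p : ℝ) ^ (δ * A₀) * (T : ℝ) := by
    have h1 : (C₀ : ℝ) * ((s : ℝ) + 1) ^ A₀ * (T : ℝ) ≤ (C₀ : ℝ) * ((2 : ℝ) ^ A₀ * (p : ℝ) ^ (δ * A₀)) * (T : ℝ) := by
      apply mul_le_mul_of_nonneg_right _ hT0
      exact mul_le_mul_of_nonneg_left hsA (Nat.cast_nonneg C₀)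
    have e : (C₀ : ℝ) * ((2 : ℝ) ^ A₀ * (p : ℝ) ^ (δ * A₀)) * (T : ℝ) = K₀ * (p : ℝ) ^ (δ * A₀) * (T : ℝ) := by
      rw [hK₀]; ring
    linarith [hquarter, hmainR, h1, e.le, e.ge]
  -- threshold: L ≤ p^δ
  have hLp : L ≤ (p : ℝ) ^ δ := by
    have hbase : L ^ (1 / δ) ≤ (p : ℝ) := hN.trans (by exact_mod_cast hpN)
    have hb0 : (0 : ℝ) ≤ L ^ (1 / δ) := Real.rpow_nonneg hL0 _
    have hmono : (L ^ (1 / δ)) ^ δ ≤ (p : ℝ) ^ δ := Real.rpow_le_rpow hb0 hbase hδpos.le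
    have hid : (L ^ (1 / δ)) ^ δ = L := by
      rw [← Real.rpow_mul hL0]
      have : (1 / δ) * δ = 1 := by field_simp
      rw [this, Real.rpow_one]
    rw [hid] at hmono; exact hmono
  by_contra hlt
  push Not at hlt
  rcases eq_or_lt_of_le hK₀0 with hK | hK
  · -- K₀ = 0: p/4 ≤ 0
    rw [← hK] at hkey
    simp at hkey
    linarith
  · -- K₀ > 0: strict chain
    have hpos : 0 < K₀ * (p : ℝ) ^ (δ * A₀) := mul_pos hK (Real.rpow_pos_of_pos hp0 _)
    have hlt2 : K₀ * (p : ℝ) ^ (δ * A₀) * (T : ℝ) < K₀ * (p : ℝ) ^ (δ * A₀) * (p : ℝ) ^ (1 / 2 + δ) :=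
      mul_lt_mul_of_pos_left hlt hpos
    have e1 : K₀ * (p : ℝ) ^ (δ * A₀) * (p : ℝ) ^ (1 / 2 + δ) = K₀ * (p : ℝ) ^ (δ * A₀ + (1 / 2 + δ)) := by
      rw [mul_assoc, ← Real.rpow_add hp0]
    have e2 : (p : ℝ) = (p : ℝ) ^ (δ * A₀ + (1 / 2 + δ)) * (p : ℝ) ^ δ := by
      rw [← Real.rpow_add hp0, hexp, Real.rpow_one]
    have hq0 : 0 < (p : ℝ) ^ (δ * A₀ + (1 / 2 + δ)) := Real.rpow_pos_of_pos hp0 _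
    -- p/4 < K₀ p^(…)  ⇒  p^(…) p^δ / 4 < K₀ p^(…)  ⇒  p^δ < 4 K₀ = L
    have h3 : (p : ℝ) ^ (δ * A₀ + (1 / 2 + δ)) * (p : ℝ) ^ δ / 4 < K₀ * (p : ℝ) ^ (δ * A₀ + (1 / 2 + δ)) := by
      have := lt_of_le_of_lt hkey hlt2
      rw [e1] at this; rw [← e2]; exact this
    have h4 : (p : ℝ) ^ δ / 4 < K₀ := by
      have h5 : (p : ℝ) ^ (δ * A₀ + (1 / 2 + δ)) * ((p : ℝ) ^ δ / 4) <
          (p : ℝ) ^ (δ * A₀ + (1 / 2 + δ)) * K₀ := by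
        have : (p : ℝ) ^ (δ * A₀ + (1 / 2 + δ)) * ((p : ℝ) ^ δ / 4) =
            (p : ℝ) ^ (δ * A₀ + (1 / 2 + δ)) * (p : ℝ) ^ δ / 4 := by ring
        rw [this, mul_comm _ K₀]; exact h3
      exact lt_of_mul_lt_mul_left h5 hq0.le
    have h6 : (p : ℝ) ^ δ < L := by rw [hL]; linarith
    linarith [hLp]


end Summit.ValiantsHypothesis.ValiantsHypothesis.Cruxes.CharPSparseSOS.SteinbergTwoCusp
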